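import Literature.Computability.Cryptography.ShorProofs
import Literature.Computability.Complexity.FoldBricks
import HarnessLib

/-!
# Shor's factoring theorem, decision form: discharge of the programming fact `factPre ∈ FP`

Sibling proofs file of `Literature/Computability/Cryptography/ShorProofs.lean` (which stays a
definitions/named-facts file for this part). It discharges the named fact
`Literature.Computability.Cryptography.factPre_mem_FP`: the classical pre-processor `factPre` of
the decision version of factoring — decode the instance as a pair `⟨N, k⟩` and hand the binary
numeral of `N` to Shor's algorithm — is polynomial-time computable.

## The argument

The pair decoder `natPairEncoding.decode` never fails (Mathlib's `encodingNatBool.decode w =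
some (decodeNat w)` reads *every* string as a numeral), so in closed form
`factPre x = encodeNat (decodeNat (boolUnpair x).1)`: the *canonical numeral* of the first
component of the pair. Both pieces are polynomial-time string functions already in the tree's
`FP` toolkit — the first projection of the pairing, `Brick.fstF` (`boolUnpairFst_mem_FP`,
`PairProjections.lean`), and the canonical-numeral brick `Brick.canonF`
(`Brick.canonF_eq_encodeNat_decodeNat`, `Brick.canonF_mem_FP`, `FoldBricks.lean`: append a final
`1` to a nonempty numeral ending in `0`, otherwise keep the string) — and `FP` is closed under
composition (`comp_mem_FP`, the tree's proof of Arora–Barak Thm 2.8). This is the folklore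
"pairing, projections and re-encoding are polynomial time" of Arora–Barak 2009, §0.1
("Representing pairs and tuples", p. 2) with the composition argument of the proof of Thm 2.8.

## References

* S. Arora, B. Barak, *Computational Complexity: A Modern Approach*, CUP 2009, §0.1
  (representing pairs and tuples, p. 2), §1.3 and proof of Thm 2.8 (polynomial time is closed
  under composition) [AroraBarak2009].
* P. W. Shor, *Polynomial-time algorithms for prime factorization and discrete logarithms on a
  quantum computer*, SIAM J. Comput. 26 (1997) 1484–1509, §5 (the theorem this feeds, via
  `ShorProofs.FACT_mem_BQP_of`) [Shor1997].

## Mathlib / tree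

From Mathlib: `Computability.encodingNatBool`, `encodeNat`, `decodeNat`. From the tree:
`factPre`, `natPairEncoding`, `factPre_mem_FP` (`ShorProofs`), `boolUnpair`,
`Encoding.pairBool` (`BoolEncodings`), `FP` (`Classes`), `comp_mem_FP` (`ReductionsProofs`),
`Brick.fstF`, `Brick.fstF_mem_FP` (`BrickAlgebra`), `Brick.canonF`, `Brick.canonF_mem_FP`,
`Brick.canonF_eq_encodeNat_decodeNat` (`FoldBricks`).

## Design notes

* Kept out of `ShorProofs.lean` itself so that the `FP` brick toolkit (`FoldBricks` and its
  stack-machine imports) does not enter the import closure of `ShorProofs` and its importers.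
* No statement is changed and no named fact is introduced: two closed-form lemmas and the
  discharge `factPre_mem_FP_holds`.
-/

noncomputable section

namespace Literature.Computability.Cryptography

open _root_.Computability Complexity

/-- **Closed form of the pre-processor**: `factPre x` is the canonical numeral
`encodeNat (decodeNat (boolUnpair x).1)` of the first component of the instance `x = ⟨N, k⟩`.
The pair-of-numerals decoder is total — `natPairEncoding.decode x` is definitionally
`some (decodeNat (boolUnpair x).1, decodeNat (boolUnpair x).2)`, because Mathlib's binary
decoder `encodingNatBool.decode` reads every string, non-canonical numerals included, as some
natural number (cf. `OFPostCF.natPairEncoding_decode` of `OrderFindingPostSpec.lean`, not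
imported here) — so the `none` branch of `factPre` is dead and the equation holds by `rfl`.
[folklore] -/
theorem factPre_apply (x : List Bool) : factPre x = encodeNat (decodeNat (boolUnpair x).1) :=
  rfl

/-- `factPre` factors through the tree's `FP` bricks: first projection of the pairing, then the
canonical-numeral brick (`Brick.canonF w = encodeNat (decodeNat w)`). [folklore] -/
theorem factPre_eq_canonF_comp_fstF : factPre = Brick.canonF ∘ Brick.fstF := by
  funext x
  rw [factPre_apply, Function.comp_apply, Brick.canonF_eq_encodeNat_decodeNat]
  rfl

/-- **Discharge of the programming fact `factPre_mem_FP`**: the pre-processor of the decision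
version of factoring (unpair, re-encode the first component) is polynomial-time computable —
the composition (`comp_mem_FP`, Arora–Barak Thm 2.8) of the first pair projection
(`Brick.fstF_mem_FP`) with the canonical-numeral brick (`Brick.canonF_mem_FP`).
(Arora–Barak 2009, §0.1 "Representing pairs and tuples", p. 2; §1.3.) [folklore] -/
theorem factPre_mem_FP_holds : factPre_mem_FP := by
  unfold factPre_mem_FP
  rw [factPre_eq_canonF_comp_fstF]
  exact comp_mem_FP Brick.canonF_mem_FP Brick.fstF_mem_FP

end Literature.Computability.Cryptography

end
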